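import Summits.NavierStokesRegularity.NavierStokesRegularity.Theorems.OddMorawetzLocal.Negative.OddMorawetzLocalRefutationData5
import Summits.NavierStokesRegularity.NavierStokesRegularity.Theorems.OddMorawetzLocal.Negative.OddMorawetzLocalRefutationDefsVI
import HarnessLib

/-!
# Crux `OddMorawetzLocal` (stmt-NavierStokesRegularity-1376) — kernel certificates, weight 5 (part B3)

The finite computations of the weight-5 half of the refutation, each a closed Boolean evaluated by the kernel
(`decide +kernel`) on the vocabulary of `OddMorawetzLocalJetAlgebra` / `…RefutationDefs{,Fast,IV,V,VI}` and the literal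
data of `…RefutationData5` (197 representatives, 50 isotropic descriptors, certificate blocks of 53/45/49 rows, prime 8191).
Part B3: the rank certificate of block 2 (49 rows/columns) of the derivation-matrix minor mod 8191, row-chunked
(`blockCheckRows`, ≤ 8 rows per theorem: kernel memory).
No analysis; lands `--supports` the crux item; consumed by the weight-5 assembly of the refutation.
-/

set_option linter.dupNamespace false

namespace Summit.NavierStokesRegularity.NavierStokesRegularity.Theorems.OddMorawetz

/-- Block `2` of the weight-5 rank certificate, rows `0 … 7`: `minor · inverse = 1 (mod 8191)` on these rows. -/
theorem cert5_blockRows_2_0 : blockCheckRows 5 lieZ reps5 (blocks5.getD 2 ([], [], [])).1 (blocks5.getD 2 ([], [], [])).2.1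
    (blocks5.getD 2 ([], [], [])).2.2 certPrime5 0 8 = true := by
  decide +kernel

/-- Block `2` of the weight-5 rank certificate, rows `8 … 15`: `minor · inverse = 1 (mod 8191)` on these rows. -/
theorem cert5_blockRows_2_1 : blockCheckRows 5 lieZ reps5 (blocks5.getD 2 ([], [], [])).1 (blocks5.getD 2 ([], [], [])).2.1
    (blocks5.getD 2 ([], [], [])).2.2 certPrime5 8 8 = true := by
  decide +kernel

/-- Block `2` of the weight-5 rank certificate, rows `16 … 23`: `minor · inverse = 1 (mod 8191)` on these rows. -/
theorem cert5_blockRows_2_2 : blockCheckRows 5 lieZ reps5 (blocks5.getD 2 ([], [], [])).1 (blocks5.getD 2 ([], [], [])).2.1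
    (blocks5.getD 2 ([], [], [])).2.2 certPrime5 16 8 = true := by
  decide +kernel

/-- Block `2` of the weight-5 rank certificate, rows `24 … 31`: `minor · inverse = 1 (mod 8191)` on these rows. -/
theorem cert5_blockRows_2_3 : blockCheckRows 5 lieZ reps5 (blocks5.getD 2 ([], [], [])).1 (blocks5.getD 2 ([], [], [])).2.1
    (blocks5.getD 2 ([], [], [])).2.2 certPrime5 24 8 = true := by
  decide +kernel

/-- Block `2` of the weight-5 rank certificate, rows `32 … 39`: `minor · inverse = 1 (mod 8191)` on these rows. -/
theorem cert5_blockRows_2_4 : blockCheckRows 5 lieZ reps5 (blocks5.getD 2 ([], [], [])).1 (blocks5.getD 2 ([], [], [])).2.1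
    (blocks5.getD 2 ([], [], [])).2.2 certPrime5 32 8 = true := by
  decide +kernel

/-- Block `2` of the weight-5 rank certificate, rows `40 … 47`: `minor · inverse = 1 (mod 8191)` on these rows. -/
theorem cert5_blockRows_2_5 : blockCheckRows 5 lieZ reps5 (blocks5.getD 2 ([], [], [])).1 (blocks5.getD 2 ([], [], [])).2.1
    (blocks5.getD 2 ([], [], [])).2.2 certPrime5 40 8 = true := by
  decide +kernel

/-- Block `2` of the weight-5 rank certificate, rows `48 … 48`: `minor · inverse = 1 (mod 8191)` on these rows. -/
theorem cert5_blockRows_2_6 : blockCheckRows 5 lieZ reps5 (blocks5.getD 2 ([], [], [])).1 (blocks5.getD 2 ([], [], [])).2.1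
    (blocks5.getD 2 ([], [], [])).2.2 certPrime5 48 1 = true := by
  decide +kernel

end Summit.NavierStokesRegularity.NavierStokesRegularity.Theorems.OddMorawetz
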